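import Summits.Ventures.HSemireg.WedgeHankelRecurrenceGaussChebyshevTaylorAtTwo

/-!
# Venture HSemireg — **CONVEXITY OF THE CHEBYSHEV AND VIETA POLYNOMIALS OFF THE ORTHOGONALITY INTERVAL: `T_n`, `U_n` are convex on `[1, ∞)`; on `(−∞, −2]` (resp. `(−∞, −1]`) `C_n, S_n` (resp. `T_n, U_n`)
# are convex for even `n` and concave for odd `n`** (transport of N549 `convexOn_chebyshevS ∕ C_real_Ici_two` along `x ↦ 2x` and `x ↦ −x` with the parities `P_n(−x) = (−1)^n P_n(x)`)

HONEST FRAMING. Part of the Lean index of the computation cell `pub-hsemireg` (seat p10 gen 49, Sunday typer «UNIFORM-IN-n»).  Elementary convexity of real polynomial functions (Mathlib `ConvexOn ∕ ConcaveOn`,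
`Polynomial.Chebyshev.T ∕ U ∕ C ∕ S` over `ℝ`); no variety, no cohomology theory, no sheaf, no Ext group and no semiregularity map is constructed here; nothing here says that HC / HC_CM / HC_AV holds; no
Literature fact (unproved `Prop`) is declared or used.  Custodian versions as in `WedgeHankelSiegelIdeal` (1/3).
SOURCES (cited).  T. J. Rivlin, *The Chebyshev Polynomials* (Wiley 1974), §1.2 and (1.97)–(1.98) (all derivatives of `T_n`, `U_n` are positive on `[1, ∞)`); J. C. Mason, D. C. Handscomb, *Chebyshev Polynomials*
(2003), §1.2, §2.4.5.
PROOF TYPED HERE.  If `f` is convex on `s`, `t` is convex and `x ∈ t ⇒ 2x ∈ s` (resp. `−x ∈ s`), then `x ↦ f(2x)` (resp. `x ↦ f(−x)`) is convex on `t` (the defining inequality, `2(ax + by) = a(2x) + b(2y)`);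
`T_n(x) = ½C_n(2x)`, `U_n(x) = S_n(2x)` (N548 `chebyshevC_eval_two_mul`, N521 `chebyshevS_eval_eq_U_eval_half`), `P_n(−x) = (−1)^n P_n(x)` (N519 `chebyshevC_eval_neg ∕ chebyshevS_eval_neg`, Mathlib
`T_eval_neg ∕ U_eval_neg`), and `ConvexOn.neg`.
DEDUP DISCLOSURE (`rg -n 'ConvexOn|ConcaveOn' Summits/Ventures/HSemireg Literature/Algebra/Polynomial Literature/Analysis/Approximation` — only N549 (this chain), 2026-09-05): no convexity statement for
`T_n ∕ U_n`, and none on the left half-line, in Mathlib or the tree; 0 hits for the 12 names below.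

WHAT IS IN THE TREE.  N549 `convexOn_chebyshevS_real_Ici_two`, `convexOn_chebyshevC_real_Ici_two`; N548 `chebyshevC_eval_two_mul`; N521 `chebyshevS_eval_eq_U_eval_half`; N519 `chebyshevC_eval_neg`,
`chebyshevS_eval_neg`; Mathlib `T_eval_neg`, `U_eval_neg`, `Int.cast_negOnePow_natCast`, `Even.neg_one_pow`, `Odd.neg_one_pow`, `ConvexOn.smul ∕ congr ∕ neg`, `convex_Ici ∕ convex_Iic`.
THIS FILE (namespace `Summit.Ventures.HSemireg.Wedge.HankelOuter` continued; CHAINED on N549; 0 definitions):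
* §1315 `convexOn_comp_two_mul_of_mapsTo`, `convexOn_comp_neg_of_mapsTo` (transport helpers), **`convexOn_chebyshevT_real_Ici_one`**, **`convexOn_chebyshevU_real_Ici_one`**,
  **`convexOn_chebyshevC_real_Iic_of_even`**, **`concaveOn_chebyshevC_real_Iic_of_odd`**, **`convexOn_chebyshevS_real_Iic_of_even`**, **`concaveOn_chebyshevS_real_Iic_of_odd`** (on `(−∞, −2]`),
  **`convexOn_chebyshevT_real_Iic_of_even`**, **`concaveOn_chebyshevT_real_Iic_of_odd`**, **`convexOn_chebyshevU_real_Iic_of_even`**, **`concaveOn_chebyshevU_real_Iic_of_odd`** (on `(−∞, −1]`).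
CAVEATS.  `n ∈ ℕ`; plain (not strict) convexity.  Nothing Ext-side.  New names only.
-/

open Module Polynomial
open scoped Matrix Polynomial

namespace Summit.Ventures.HSemireg.Wedge.HankelOuter

/-! ## §1315. Convexity of `T_n`, `U_n`, `C_n`, `S_n` off the interval -/

/-! ### Transport helpers -/

/-- If `f` is convex on `s`, `t` is convex and `2x ∈ s` for `x ∈ t`, then `x ↦ f(2x)` is convex on `t`. [this file, §1315] -/
theorem convexOn_comp_two_mul_of_mapsTo {f : ℝ → ℝ} {s t : Set ℝ} (hf : ConvexOn ℝ s f) (ht : Convex ℝ t) (hst : ∀ x ∈ t, 2 * x ∈ s) :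
    ConvexOn ℝ t (fun x : ℝ => f (2 * x)) := by
  refine ⟨ht, fun x hx y hy a b ha hb hab => ?_⟩
  have h := hf.2 (hst x hx) (hst y hy) ha hb hab
  simp only [smul_eq_mul] at h ⊢
  rw [show 2 * (a * x + b * y) = a * (2 * x) + b * (2 * y) by ring]
  exact h

/-- If `f` is convex on `s`, `t` is convex and `−x ∈ s` for `x ∈ t`, then `x ↦ f(−x)` is convex on `t`. [this file, §1315] -/
theorem convexOn_comp_neg_of_mapsTo {f : ℝ → ℝ} {s t : Set ℝ} (hf : ConvexOn ℝ s f) (ht : Convex ℝ t) (hst : ∀ x ∈ t, -x ∈ s) :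
    ConvexOn ℝ t (fun x : ℝ => f (-x)) := by
  refine ⟨ht, fun x hx y hy a b ha hb hab => ?_⟩
  have h := hf.2 (hst x hx) (hst y hy) ha hb hab
  simp only [smul_eq_mul] at h ⊢
  rw [show -(a * x + b * y) = a * -x + b * -y by ring]
  exact h

/-! ### `T_n`, `U_n` on `[1, ∞)` -/

/-- **`T_n` is convex on `[1, ∞)`** (`T_n(x) = ½C_n(2x)`). [Rivlin 1974, §1.2; this file, §1315] -/
theorem convexOn_chebyshevT_real_Ici_one (n : ℕ) : ConvexOn ℝ (Set.Ici (1 : ℝ)) (fun x : ℝ => (Polynomial.Chebyshev.T ℝ (n : ℤ)).eval x) := by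
  have h := convexOn_comp_two_mul_of_mapsTo (convexOn_chebyshevC_real_Ici_two n) (convex_Ici 1) (fun x hx => by simp only [Set.mem_Ici] at hx ⊢; linarith)
  refine (h.smul (by norm_num : (0 : ℝ) ≤ 1 / 2)).congr (fun x _ => ?_)
  simp only [smul_eq_mul, chebyshevC_eval_two_mul]
  ring

/-- **`U_n` is convex on `[1, ∞)`** (`U_n(x) = S_n(2x)`). [Rivlin 1974, §1.2; this file, §1315] -/
theorem convexOn_chebyshevU_real_Ici_one (n : ℕ) : ConvexOn ℝ (Set.Ici (1 : ℝ)) (fun x : ℝ => (Polynomial.Chebyshev.U ℝ (n : ℤ)).eval x) := by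
  have h := convexOn_comp_two_mul_of_mapsTo (convexOn_chebyshevS_real_Ici_two n) (convex_Ici 1) (fun x hx => by simp only [Set.mem_Ici] at hx ⊢; linarith)
  refine h.congr (fun x _ => ?_)
  simp only [chebyshevS_eval_eq_U_eval_half, show (2 : ℝ) * x / 2 = x by ring]

/-! ### `C_n`, `S_n` on `(−∞, −2]` -/

/-- **`C_n` is convex on `(−∞, −2]` for even `n`.** [this file, §1315] -/
theorem convexOn_chebyshevC_real_Iic_of_even {n : ℕ} (he : Even n) : ConvexOn ℝ (Set.Iic (-2 : ℝ)) (fun x : ℝ => (Polynomial.Chebyshev.C ℝ (n : ℤ)).eval x) := by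
  have h := convexOn_comp_neg_of_mapsTo (convexOn_chebyshevC_real_Ici_two n) (convex_Iic (-2)) (fun x hx => by simp only [Set.mem_Iic, Set.mem_Ici] at hx ⊢; linarith)
  refine h.congr (fun x _ => ?_)
  simp only [chebyshevC_eval_neg, he.neg_one_pow, one_mul]

/-- **`C_n` is concave on `(−∞, −2]` for odd `n`.** [this file, §1315] -/
theorem concaveOn_chebyshevC_real_Iic_of_odd {n : ℕ} (ho : Odd n) : ConcaveOn ℝ (Set.Iic (-2 : ℝ)) (fun x : ℝ => (Polynomial.Chebyshev.C ℝ (n : ℤ)).eval x) := by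
  have h := convexOn_comp_neg_of_mapsTo (convexOn_chebyshevC_real_Ici_two n) (convex_Iic (-2)) (fun x hx => by simp only [Set.mem_Iic, Set.mem_Ici] at hx ⊢; linarith)
  refine h.neg.congr (fun x _ => ?_)
  simp only [Pi.neg_apply, chebyshevC_eval_neg, ho.neg_one_pow, neg_mul, one_mul, neg_neg]

/-- **`S_n` is convex on `(−∞, −2]` for even `n`.** [this file, §1315] -/
theorem convexOn_chebyshevS_real_Iic_of_even {n : ℕ} (he : Even n) : ConvexOn ℝ (Set.Iic (-2 : ℝ)) (fun x : ℝ => (Polynomial.Chebyshev.S ℝ (n : ℤ)).eval x) := by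
  have h := convexOn_comp_neg_of_mapsTo (convexOn_chebyshevS_real_Ici_two n) (convex_Iic (-2)) (fun x hx => by simp only [Set.mem_Iic, Set.mem_Ici] at hx ⊢; linarith)
  refine h.congr (fun x _ => ?_)
  simp only [chebyshevS_eval_neg, he.neg_one_pow, one_mul]

/-- **`S_n` is concave on `(−∞, −2]` for odd `n`.** [this file, §1315] -/
theorem concaveOn_chebyshevS_real_Iic_of_odd {n : ℕ} (ho : Odd n) : ConcaveOn ℝ (Set.Iic (-2 : ℝ)) (fun x : ℝ => (Polynomial.Chebyshev.S ℝ (n : ℤ)).eval x) := by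
  have h := convexOn_comp_neg_of_mapsTo (convexOn_chebyshevS_real_Ici_two n) (convex_Iic (-2)) (fun x hx => by simp only [Set.mem_Iic, Set.mem_Ici] at hx ⊢; linarith)
  refine h.neg.congr (fun x _ => ?_)
  simp only [Pi.neg_apply, chebyshevS_eval_neg, ho.neg_one_pow, neg_mul, one_mul, neg_neg]

/-! ### `T_n`, `U_n` on `(−∞, −1]` -/

/-- **`T_n` is convex on `(−∞, −1]` for even `n`.** [this file, §1315] -/
theorem convexOn_chebyshevT_real_Iic_of_even {n : ℕ} (he : Even n) : ConvexOn ℝ (Set.Iic (-1 : ℝ)) (fun x : ℝ => (Polynomial.Chebyshev.T ℝ (n : ℤ)).eval x) := by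
  have h := convexOn_comp_neg_of_mapsTo (convexOn_chebyshevT_real_Ici_one n) (convex_Iic (-1)) (fun x hx => by simp only [Set.mem_Iic, Set.mem_Ici] at hx ⊢; linarith)
  refine h.congr (fun x _ => ?_)
  simp only [Polynomial.Chebyshev.T_eval_neg, Int.cast_negOnePow_natCast, he.neg_one_pow, one_mul]

/-- **`T_n` is concave on `(−∞, −1]` for odd `n`.** [this file, §1315] -/
theorem concaveOn_chebyshevT_real_Iic_of_odd {n : ℕ} (ho : Odd n) : ConcaveOn ℝ (Set.Iic (-1 : ℝ)) (fun x : ℝ => (Polynomial.Chebyshev.T ℝ (n : ℤ)).eval x) := by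
  have h := convexOn_comp_neg_of_mapsTo (convexOn_chebyshevT_real_Ici_one n) (convex_Iic (-1)) (fun x hx => by simp only [Set.mem_Iic, Set.mem_Ici] at hx ⊢; linarith)
  refine h.neg.congr (fun x _ => ?_)
  simp only [Pi.neg_apply, Polynomial.Chebyshev.T_eval_neg, Int.cast_negOnePow_natCast, ho.neg_one_pow, neg_mul, one_mul, neg_neg]

/-- **`U_n` is convex on `(−∞, −1]` for even `n`.** [this file, §1315] -/
theorem convexOn_chebyshevU_real_Iic_of_even {n : ℕ} (he : Even n) : ConvexOn ℝ (Set.Iic (-1 : ℝ)) (fun x : ℝ => (Polynomial.Chebyshev.U ℝ (n : ℤ)).eval x) := by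
  have h := convexOn_comp_neg_of_mapsTo (convexOn_chebyshevU_real_Ici_one n) (convex_Iic (-1)) (fun x hx => by simp only [Set.mem_Iic, Set.mem_Ici] at hx ⊢; linarith)
  refine h.congr (fun x _ => ?_)
  simp only [Polynomial.Chebyshev.U_eval_neg, Int.cast_negOnePow_natCast, he.neg_one_pow, one_mul]

/-- **`U_n` is concave on `(−∞, −1]` for odd `n`.** [this file, §1315] -/
theorem concaveOn_chebyshevU_real_Iic_of_odd {n : ℕ} (ho : Odd n) : ConcaveOn ℝ (Set.Iic (-1 : ℝ)) (fun x : ℝ => (Polynomial.Chebyshev.U ℝ (n : ℤ)).eval x) := by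
  have h := convexOn_comp_neg_of_mapsTo (convexOn_chebyshevU_real_Ici_one n) (convex_Iic (-1)) (fun x hx => by simp only [Set.mem_Iic, Set.mem_Ici] at hx ⊢; linarith)
  refine h.neg.congr (fun x _ => ?_)
  simp only [Pi.neg_apply, Polynomial.Chebyshev.U_eval_neg, Int.cast_negOnePow_natCast, ho.neg_one_pow, neg_mul, one_mul, neg_neg]

end Summit.Ventures.HSemireg.Wedge.HankelOuter
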